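import Summits.Langlands.Langlands.Theorems.LevelOneDyadicPrimitive
import Literature.NumberTheory.Automorphic.ReciprocityGLnRestrictionProofs
import Literature.NumberTheory.GaloisRepresentations.InducedAEUnramified
import Literature.NumberTheory.GaloisRepresentations.DrigArtinianFunctor
import Literature.NumberTheory.GaloisRepresentations.GaloisRepOfLadicLimit
import Literature.NumberTheory.GaloisRepresentations.FramedRepBlockSum

/-!
# Level-one dyadic companions, part 9b: the Kronecker cell TP and the twisted base-change cell FD PROVED; R ⟺ PR′

decomp-langlands lens-4 g13 node `PrimitiveCompanionCore` v2 (crit-1 row 156 fix F1), proofs module (= the tail of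
HOME/nodes/lens-4-g13-PrimitiveCompanionCore.full.lean, sha256 b6af5afdab67…, lines 421–616 verbatim; tree twin landed by census-1 g16).
TP: companions of the two Lie-irreducible level-one factors by the carried IH, Kronecker product of the companions (seam: power sums /
Newton identities, `charpoly_kronecker_of_eq_prod`).  FD (twisted): restriction of the IH-companion of ρ₀ along K₀ ⊆ K, twisted by the
IH-companion of the level-one character χ (slice (1,[K:ℚ]) < (n,[K:ℚ]) since 2 ≤ n).  Consequence: `primitiveCompanionCore_iff_lieIrreducibleCompanion`
— the residual of the companion lineage is EXACTLY the primitive core PR′.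
-/

/-! ## Parts 9b / 9c (lens-4 g13, inlined; v2): the two ATTACKABLE cells PROVED OUTRIGHT
TP (`kroneckerCompanionCell_text`): Kronecker product `FramedRep.tensor` of the IH-companions of the two factors; SEAM
`charpoly_kronecker_of_eq_prod` (χ_{A ⊗ B} = ∏ (X − xy), Newton via `LadicLimit.matrix_trace_pow_eq_sum_roots_pow` /
`LadicLimit.multiset_eq_of_psum_eq`).
FD (`baseChangedCompanionCell_text`, TWISTED dial): restrict the IH-companion of ρ₀ to Γ_K and twist by the IH-companion of χ
(`FramedRep.reindex (finCongr (Nat.mul_one n)) (FramedRep.tensor _ _)`; Frobenius seams = the restriction lemma + the b = 1 Kronecker seam). -/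

set_option linter.dupNamespace false

namespace Summit.Langlands.Langlands.Theorems.LevelOneDyadic.PrimitiveProofs

open scoped NumberField
open Filter IsDedekindDomain Polynomial
open Literature.NumberTheory.GaloisRepresentations Literature.NumberTheory.Automorphic

section Seam

variable {F : Type*} [Field F]

/-- `(A ⊗ₖ B)^j = A^j ⊗ₖ B^j`. -/
theorem kronecker_pow {ι κ : Type*} [Fintype ι] [DecidableEq ι] [Fintype κ] [DecidableEq κ]
    (A : Matrix ι ι F) (B : Matrix κ κ F) (j : ℕ) :
    (Matrix.kroneckerMap (· * ·) A B) ^ j = Matrix.kroneckerMap (· * ·) (A ^ j) (B ^ j) := by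
  induction j with
  | zero => rw [pow_zero, pow_zero, pow_zero, Matrix.one_kronecker_one]
  | succ j ih => rw [pow_succ, pow_succ, pow_succ, ih, ← Matrix.mul_kronecker_mul]

/-- `(s.map f) ×ˢ (t.map g) = (s ×ˢ t).map (Prod.map f g)`. -/
theorem map_product_map {α β γ δ : Type*} (s : Multiset α) (t : Multiset β) (f : α → γ) (g : β → δ) :
    (s.map f) ×ˢ (t.map g) = (s ×ˢ t).map (Prod.map f g) := by
  induction s using Multiset.induction_on with
  | empty => rw [Multiset.map_zero, Multiset.zero_product, Multiset.zero_product, Multiset.map_zero]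
  | cons a s ih =>
    rw [Multiset.map_cons, Multiset.cons_product, Multiset.cons_product, Multiset.map_add, ih,
      Multiset.map_map, Multiset.map_map]
    rfl

/-- Power sums of the product multiset: `Σ_{(x,y) ∈ s × t} (xy)^j = (Σ_s x^j)(Σ_t y^j)`. -/
theorem psum_product {A : Type*} [CommSemiring A] (s t : Multiset A) (j : ℕ) :
    (((s ×ˢ t).map fun p => p.1 * p.2).map (· ^ j)).sum = (s.map (· ^ j)).sum * (t.map (· ^ j)).sum := by
  rw [Multiset.map_map]
  induction s using Multiset.induction_on with
  | empty => rw [Multiset.zero_product, Multiset.map_zero, Multiset.map_zero, Multiset.sum_zero, zero_mul]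
  | cons a s ih =>
    rw [Multiset.cons_product, Multiset.map_add, Multiset.sum_add, ih, Multiset.map_cons, Multiset.sum_cons,
      add_mul]
    congr 1
    simp only [Multiset.map_map, Function.comp_def, mul_pow]
    rw [Multiset.sum_map_mul_left]

/-- **Characteristic polynomial of a Kronecker product** (algebraically closed, characteristic `0`): if
`χ_A = ∏_{x ∈ s} (X - x)` and `χ_B = ∏_{y ∈ t} (X - y)` then `χ_{A ⊗ₖ B} = ∏_{(x,y) ∈ s × t} (X - xy)`.  Newton:
`tr((A ⊗ₖ B)^j) = tr(A^j) · tr(B^j) = Σ (xy)^j`, and a multiset is determined by its power sums. -/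
theorem charpoly_kronecker_of_eq_prod [IsAlgClosed F] [CharZero F] {ι κ : Type*} [Fintype ι] [DecidableEq ι]
    [Fintype κ] [DecidableEq κ] {A : Matrix ι ι F} {B : Matrix κ κ F} {s t : Multiset F}
    (hA : A.charpoly = (s.map fun x => X - C x).prod) (hB : B.charpoly = (t.map fun x => X - C x).prod) :
    (Matrix.kroneckerMap (· * ·) A B).charpoly = (((s ×ˢ t).map fun p => p.1 * p.2).map fun x => X - C x).prod := by
  classical
  have hs : Multiset.card s = Fintype.card ι := by
    have h := congrArg Polynomial.natDegree hA
    rw [Matrix.charpoly_natDegree_eq_dim, natDegree_multiset_prod_X_sub_C_eq_card] at h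
    exact h.symm
  have ht : Multiset.card t = Fintype.card κ := by
    have h := congrArg Polynomial.natDegree hB
    rw [Matrix.charpoly_natDegree_eq_dim, natDegree_multiset_prod_X_sub_C_eq_card] at h
    exact h.symm
  have hMr : Multiset.card (Matrix.kroneckerMap (· * ·) A B).charpoly.roots = Fintype.card (ι × κ) := by
    rw [splits_iff_card_roots.1 (IsAlgClosed.splits _), Matrix.charpoly_natDegree_eq_dim]
  have hroots : (Matrix.kroneckerMap (· * ·) A B).charpoly.roots = (s ×ˢ t).map fun p => p.1 * p.2 := by
    refine LadicLimit.multiset_eq_of_psum_eq hMr ?_ fun j _ _ => ?_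
    · rw [Multiset.card_map, Multiset.card_product, hs, ht, Fintype.card_prod]
    · rw [← LadicLimit.matrix_trace_pow_eq_sum_roots_pow, kronecker_pow, Matrix.trace_kronecker,
        LadicLimit.matrix_trace_pow_eq_sum_roots_pow, LadicLimit.matrix_trace_pow_eq_sum_roots_pow, hA, hB,
        roots_multiset_prod_X_sub_C, roots_multiset_prod_X_sub_C, psum_product]
  rw [← prod_multiset_X_sub_C_of_monic_of_roots_card_eq (Matrix.charpoly_monic _)
    (by rw [hMr, Matrix.charpoly_natDegree_eq_dim]), hroots]

end Seam

section Satake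

variable {p : ℕ} [Fact p.Prime]

/-- `arithFrobPolyOfSatake ι q 1 α` as `∏ (X - x)` over the multiset `α.map (a ↦ ι⁻¹(a⁻¹))`. -/
theorem arithFrobPolyOfSatake_one_eq (ι : PadicAlgCl p ≃+* ℂ) (q : ℕ) (α : Multiset ℂ) :
    arithFrobPolyOfSatake ι q 1 α =
      ((α.map fun a => ι.symm (((Real.sqrt q : ℝ) : ℂ) ^ (1 - 1) * a)⁻¹).map fun x => X - C x).prod := by
  rw [arithFrobPolyOfSatake, Multiset.map_map, Function.comp_def]

/-- The Satake parameter of a Kronecker product is the product multiset (weight-0 normalisation `m = 1`). -/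
theorem arithFrobPolyOfSatake_one_product (ι : PadicAlgCl p ≃+* ℂ) (q : ℕ) (α₁ α₂ : Multiset ℂ) :
    arithFrobPolyOfSatake ι q 1 ((α₁ ×ˢ α₂).map fun c => c.1 * c.2) =
      ((((α₁.map fun a => ι.symm (((Real.sqrt q : ℝ) : ℂ) ^ (1 - 1) * a)⁻¹) ×ˢ
          (α₂.map fun a => ι.symm (((Real.sqrt q : ℝ) : ℂ) ^ (1 - 1) * a)⁻¹)).map fun c => c.1 * c.2).map
        fun x => X - C x).prod := by
  rw [arithFrobPolyOfSatake, map_product_map, Multiset.map_map, Multiset.map_map, Multiset.map_map]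
  refine congrArg _ (Multiset.map_congr rfl fun c _ => ?_)
  simp only [Function.comp_apply, Prod.map_fst, Prod.map_snd, Nat.sub_self, pow_zero, one_mul, map_mul, mul_inv]

end Satake

/-- **TP holds** (the Kronecker cell of the companion box): tensor the IH-companions of the two factors. -/
theorem kroneckerCompanionCell_text :
    ∀ (K : Type) [Field K] [NumberField K] (n : ℕ), 0 < n → ∀ (ℓ : ℕ) [Fact ℓ.Prime], ℓ ≠ 2 → ∀ (ι : PadicAlgCl ℓ ≃+* ℂ) (ρ : Literature.NumberTheory.GaloisRepresentations.FramedGaloisRep K (PadicAlgCl ℓ) n), ρ.toGaloisRep.IsIrreducible → (∀ (L : Type) [Field L] [NumberField L] [Algebra K L], (ρ.restrictField L).toGaloisRep.IsIrreducible) → ((∀ᶠ v : IsDedekindDomain.HeightOneSpectrum (NumberField.RingOfIntegers K) in cofinite, ρ.IsUnramifiedAt v) ∧ ∀ (v : IsDedekindDomain.HeightOneSpectrum (NumberField.RingOfIntegers K)) (hv : ((ℓ : ℕ) : NumberField.RingOfIntegers K) ∈ v.asIdeal), (Literature.NumberTheory.PAdicHodge.fontainePstAdicCompletion v ℓ hv).IsDeRhamFramed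 (ρ.toLocal v)) → (∀ (v : IsDedekindDomain.HeightOneSpectrum (NumberField.RingOfIntegers K)) (hv : ((ℓ : ℕ) : NumberField.RingOfIntegers K) ∈ v.asIdeal), (Literature.NumberTheory.PAdicHodge.fontainePstAdicCompletion v ℓ hv).IsCrystallineFramed (ρ.toLocal v)) → (∀ w : IsDedekindDomain.HeightOneSpectrum (NumberField.RingOfIntegers K), ((ℓ : ℕ) : NumberField.RingOfIntegers K) ∉ w.asIdeal → ρ.IsUnramifiedAt w) → (∀ (d' n' : ℕ), (n' < n ∨ (n' = n ∧ d' < Module.finrank ℚ K)) → ∀ (K' : Type) [Field K'] [NumberField K'], Module.finrank ℚ K' = d' → 0 < n' → ∀ (ℓ' : ℕ) [Fact ℓ'.Prime], ℓ' ≠ 2 → ∀ (ι' : PadicAlgCl ℓ' ≃+* ℂ) (σ : Literature.NumberTheory.GaloisRepresentations.FramedGaloisRep K' (PadicAlgCl ℓ') n'), σ.toGaloisRep.IsIrreducible → (∀ (L : Type) [Field L] [NumberField L] [Algebra K' L], (σ.restrictField L).toGaloisRep.IsIrreducible) → ((∀ᶠ v : IsDedekindDomain.HeightOneSpectrum (NumberField.RingOfIntegers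 K') in cofinite, σ.IsUnramifiedAt v) ∧ ∀ (v : IsDedekindDomain.HeightOneSpectrum (NumberField.RingOfIntegers K')) (hv : ((ℓ' : ℕ) : NumberField.RingOfIntegers K') ∈ v.asIdeal), (Literature.NumberTheory.PAdicHodge.fontainePstAdicCompletion v ℓ' hv).IsDeRhamFramed (σ.toLocal v)) → (∀ (v : IsDedekindDomain.HeightOneSpectrum (NumberField.RingOfIntegers K')) (hv : ((ℓ' : ℕ) : NumberField.RingOfIntegers K') ∈ v.asIdeal), (Literature.NumberTheory.PAdicHodge.fontainePstAdicCompletion v ℓ' hv).IsCrystallineFramed (σ.toLocal v)) → (∀ w : IsDedekindDomain.HeightOneSpectrum (NumberField.RingOfIntegers K'), ((ℓ' : ℕ) : NumberField.RingOfIntegers K') ∉ w.asIdeal → σ.IsUnramifiedAt w) → ∀ (ι₂' : PadicAlgCl 2 ≃+* ℂ), ∃ σ₂ : Literature.NumberTheory.GaloisRepresentations.FramedGaloisRep K' (PadicAlgCl 2) n', (∀ᶠ v : IsDedekindDomain.HeightOneSpectrum (NumberField.RingOfIntegers K') in cofinite, σ₂.IsUnramifiedAt v) ∧ (∀ᶠ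 v : IsDedekindDomain.HeightOneSpectrum (NumberField.RingOfIntegers K') in cofinite, ∃ α : Multiset ℂ, σ.HasFrobCharpolyAt v (Literature.NumberTheory.Automorphic.arithFrobPolyOfSatake ι' v.residueCard 1 α) ∧ σ₂.HasFrobCharpolyAt v (Literature.NumberTheory.Automorphic.arithFrobPolyOfSatake ι₂' v.residueCard 1 α))) → (∃ (a b : ℕ) (σ₁ : Literature.NumberTheory.GaloisRepresentations.FramedGaloisRep K (PadicAlgCl ℓ) a) (σ₂ : Literature.NumberTheory.GaloisRepresentations.FramedGaloisRep K (PadicAlgCl ℓ) b), 2 ≤ a ∧ 2 ≤ b ∧ n = a * b ∧ (σ₁.toGaloisRep.IsIrreducible ∧ (∀ (L : Type) [Field L] [NumberField L] [Algebra K L], (σ₁.restrictField L).toGaloisRep.IsIrreducible) ∧ ((∀ᶠ v : IsDedekindDomain.HeightOneSpectrum (NumberField.RingOfIntegers K) in cofinite, σ₁.IsUnramifiedAt v) ∧ ∀ (v : IsDedekindDomain.HeightOneSpectrum (NumberField.RingOfIntegers K)) (hv : ((ℓ : ℕ) : NumberField.RingOfIntegers K) ∈ v.asIdeal), (Literature.NumberTheory.PAdicHodge.fontainePstAdicCompletion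 v ℓ hv).IsDeRhamFramed (σ₁.toLocal v)) ∧ (∀ (v : IsDedekindDomain.HeightOneSpectrum (NumberField.RingOfIntegers K)) (hv : ((ℓ : ℕ) : NumberField.RingOfIntegers K) ∈ v.asIdeal), (Literature.NumberTheory.PAdicHodge.fontainePstAdicCompletion v ℓ hv).IsCrystallineFramed (σ₁.toLocal v)) ∧ (∀ w : IsDedekindDomain.HeightOneSpectrum (NumberField.RingOfIntegers K), ((ℓ : ℕ) : NumberField.RingOfIntegers K) ∉ w.asIdeal → σ₁.IsUnramifiedAt w)) ∧ (σ₂.toGaloisRep.IsIrreducible ∧ (∀ (L : Type) [Field L] [NumberField L] [Algebra K L], (σ₂.restrictField L).toGaloisRep.IsIrreducible) ∧ ((∀ᶠ v : IsDedekindDomain.HeightOneSpectrum (NumberField.RingOfIntegers K) in cofinite, σ₂.IsUnramifiedAt v) ∧ ∀ (v : IsDedekindDomain.HeightOneSpectrum (NumberField.RingOfIntegers K)) (hv : ((ℓ : ℕ) : NumberField.RingOfIntegers K) ∈ v.asIdeal), (Literature.NumberTheory.PAdicHodge.fontainePstAdicCompletion v ℓ hv).IsDeRhamFramed (σ₂.toLocal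 v)) ∧ (∀ (v : IsDedekindDomain.HeightOneSpectrum (NumberField.RingOfIntegers K)) (hv : ((ℓ : ℕ) : NumberField.RingOfIntegers K) ∈ v.asIdeal), (Literature.NumberTheory.PAdicHodge.fontainePstAdicCompletion v ℓ hv).IsCrystallineFramed (σ₂.toLocal v)) ∧ (∀ w : IsDedekindDomain.HeightOneSpectrum (NumberField.RingOfIntegers K), ((ℓ : ℕ) : NumberField.RingOfIntegers K) ∉ w.asIdeal → σ₂.IsUnramifiedAt w)) ∧ ∀ g : Field.absoluteGaloisGroup K, Literature.NumberTheory.GaloisRepresentations.FramedRep.charpoly ρ g = (Matrix.kroneckerMap (· * ·) ((σ₁ g : GL (Fin a) (PadicAlgCl ℓ)) : Matrix (Fin a) (Fin a) (PadicAlgCl ℓ)) ((σ₂ g : GL (Fin b) (PadicAlgCl ℓ)) : Matrix (Fin b) (Fin b) (PadicAlgCl ℓ))).charpoly) → ∀ (ι₂ : PadicAlgCl 2 ≃+* ℂ), ∃ ρ₂ : Literature.NumberTheory.GaloisRepresentations.FramedGaloisRep K (PadicAlgCl 2) n, (∀ᶠ v : IsDedekindDomain.HeightOneSpectrum (NumberField.RingOfIntegers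 K) in cofinite, ρ₂.IsUnramifiedAt v) ∧ (∀ᶠ v : IsDedekindDomain.HeightOneSpectrum (NumberField.RingOfIntegers K) in cofinite, ∃ α : Multiset ℂ, ρ.HasFrobCharpolyAt v (Literature.NumberTheory.Automorphic.arithFrobPolyOfSatake ι v.residueCard 1 α) ∧ ρ₂.HasFrobCharpolyAt v (Literature.NumberTheory.Automorphic.arithFrobPolyOfSatake ι₂ v.residueCard 1 α)) := by
  intro K _ _ n hn ℓ _ hℓ ι ρ hirr hLie hgeo hcrys hlvl IH hK ι₂
  obtain ⟨a, b, σ₁, σ₂, ha, hb, hnab, ⟨hirr₁, hLie₁, hgeo₁, hcrys₁, hlvl₁⟩, ⟨hirr₂, hLie₂, hgeo₂, hcrys₂, hlvl₂⟩,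
    hchar⟩ := hK
  subst hnab
  have ha' : a < a * b := by nlinarith
  have hb' : b < a * b := by nlinarith
  obtain ⟨τ₁, hur₁, hm₁⟩ :=
    IH (Module.finrank ℚ K) a (Or.inl ha') K rfl (by omega) ℓ hℓ ι σ₁ hirr₁ hLie₁ hgeo₁ hcrys₁ hlvl₁ ι₂
  obtain ⟨τ₂, hur₂, hm₂⟩ :=
    IH (Module.finrank ℚ K) b (Or.inl hb') K rfl (by omega) ℓ hℓ ι σ₂ hirr₂ hLie₂ hgeo₂ hcrys₂ hlvl₂ ι₂
  refine ⟨FramedRep.tensor τ₁ τ₂, ?_, ?_⟩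
  · filter_upwards [hur₁, hur₂] with v h₁ h₂
    intro 𝔓 h𝔓 g hg
    rw [FramedRep.tensor_apply, h₁ 𝔓 h𝔓 g hg, h₂ 𝔓 h𝔓 g hg, glKronecker_one]
  · filter_upwards [hm₁, hm₂] with v h₁ h₂
    obtain ⟨α₁, h₁ℓ, h₁₂⟩ := h₁
    obtain ⟨α₂, h₂ℓ, h₂₂⟩ := h₂
    refine ⟨(α₁ ×ˢ α₂).map fun c => c.1 * c.2, ?_, ?_⟩
    · intro 𝔓 h𝔓 g hg
      have e₁ : ((σ₁ g : GL (Fin a) (PadicAlgCl ℓ)) : Matrix (Fin a) (Fin a) (PadicAlgCl ℓ)).charpoly = _ :=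
        (h₁ℓ 𝔓 h𝔓 g hg).trans (arithFrobPolyOfSatake_one_eq ι _ α₁)
      have e₂ : ((σ₂ g : GL (Fin b) (PadicAlgCl ℓ)) : Matrix (Fin b) (Fin b) (PadicAlgCl ℓ)).charpoly = _ :=
        (h₂ℓ 𝔓 h𝔓 g hg).trans (arithFrobPolyOfSatake_one_eq ι _ α₂)
      rw [hchar g, charpoly_kronecker_of_eq_prod e₁ e₂, arithFrobPolyOfSatake_one_product]
    · intro 𝔓 h𝔓 g hg
      have e₁ : ((τ₁ g : GL (Fin a) (PadicAlgCl 2)) : Matrix (Fin a) (Fin a) (PadicAlgCl 2)).charpoly = _ :=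
        (h₁₂ 𝔓 h𝔓 g hg).trans (arithFrobPolyOfSatake_one_eq ι₂ _ α₁)
      have e₂ : ((τ₂ g : GL (Fin b) (PadicAlgCl 2)) : Matrix (Fin b) (Fin b) (PadicAlgCl 2)).charpoly = _ :=
        (h₂₂ 𝔓 h𝔓 g hg).trans (arithFrobPolyOfSatake_one_eq ι₂ _ α₂)
      rw [FramedRep.charpoly, FramedRep.tensor_apply, coe_glKronecker, Matrix.charpoly_reindex,
        charpoly_kronecker_of_eq_prod e₁ e₂, arithFrobPolyOfSatake_one_product]

/-! ## FD (v2, twisted): restriction of the companion of ρ₀, twisted by the companion of χ -/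

/-- **The twisted base-change cell FD holds** (its filed text, verbatim). -/
theorem baseChangedCompanionCell_text :
    ∀ (K : Type) [Field K] [NumberField K] (n : ℕ), 0 < n → ∀ (ℓ : ℕ) [Fact ℓ.Prime], ℓ ≠ 2 → ∀ (ι : PadicAlgCl ℓ ≃+* ℂ) (ρ : Literature.NumberTheory.GaloisRepresentations.FramedGaloisRep K (PadicAlgCl ℓ) n), ρ.toGaloisRep.IsIrreducible → (∀ (L : Type) [Field L] [NumberField L] [Algebra K L], (ρ.restrictField L).toGaloisRep.IsIrreducible) → ((∀ᶠ v : IsDedekindDomain.HeightOneSpectrum (NumberField.RingOfIntegers K) in cofinite, ρ.IsUnramifiedAt v) ∧ ∀ (v : IsDedekindDomain.HeightOneSpectrum (NumberField.RingOfIntegers K)) (hv : ((ℓ : ℕ) : NumberField.RingOfIntegers K) ∈ v.asIdeal), (Literature.NumberTheory.PAdicHodge.fontainePstAdicCompletion v ℓ hv).IsDeRhamFramed (ρ.toLocal v)) → (∀ (v : IsDedekindDomain.HeightOneSpectrum (NumberField.RingOfIntegers K)) (hv : ((ℓ : ℕ) : NumberField.RingOfIntegers K) ∈ v.asIdeal),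 (Literature.NumberTheory.PAdicHodge.fontainePstAdicCompletion v ℓ hv).IsCrystallineFramed (ρ.toLocal v)) → (∀ w : IsDedekindDomain.HeightOneSpectrum (NumberField.RingOfIntegers K), ((ℓ : ℕ) : NumberField.RingOfIntegers K) ∉ w.asIdeal → ρ.IsUnramifiedAt w) → (∀ (d' n' : ℕ), (n' < n ∨ (n' = n ∧ d' < Module.finrank ℚ K)) → ∀ (K' : Type) [Field K'] [NumberField K'], Module.finrank ℚ K' = d' → 0 < n' → ∀ (ℓ' : ℕ) [Fact ℓ'.Prime], ℓ' ≠ 2 → ∀ (ι' : PadicAlgCl ℓ' ≃+* ℂ) (σ : Literature.NumberTheory.GaloisRepresentations.FramedGaloisRep K' (PadicAlgCl ℓ') n'), σ.toGaloisRep.IsIrreducible → (∀ (L : Type) [Field L] [NumberField L] [Algebra K' L], (σ.restrictField L).toGaloisRep.IsIrreducible) → ((∀ᶠ v : IsDedekindDomain.HeightOneSpectrum (NumberField.RingOfIntegers K') in cofinite, σ.IsUnramifiedAt v) ∧ ∀ (v : IsDedekindDomain.HeightOneSpectrum (NumberField.RingOfIntegers K')) (hv : ((ℓ' : ℕ) :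 NumberField.RingOfIntegers K') ∈ v.asIdeal), (Literature.NumberTheory.PAdicHodge.fontainePstAdicCompletion v ℓ' hv).IsDeRhamFramed (σ.toLocal v)) → (∀ (v : IsDedekindDomain.HeightOneSpectrum (NumberField.RingOfIntegers K')) (hv : ((ℓ' : ℕ) : NumberField.RingOfIntegers K') ∈ v.asIdeal), (Literature.NumberTheory.PAdicHodge.fontainePstAdicCompletion v ℓ' hv).IsCrystallineFramed (σ.toLocal v)) → (∀ w : IsDedekindDomain.HeightOneSpectrum (NumberField.RingOfIntegers K'), ((ℓ' : ℕ) : NumberField.RingOfIntegers K') ∉ w.asIdeal → σ.IsUnramifiedAt w) → ∀ (ι₂' : PadicAlgCl 2 ≃+* ℂ), ∃ σ₂ : Literature.NumberTheory.GaloisRepresentations.FramedGaloisRep K' (PadicAlgCl 2) n', (∀ᶠ v : IsDedekindDomain.HeightOneSpectrum (NumberField.RingOfIntegers K') in cofinite, σ₂.IsUnramifiedAt v) ∧ (∀ᶠ v : IsDedekindDomain.HeightOneSpectrum (NumberField.RingOfIntegers K') in cofinite, ∃ α : Multiset ℂ, σ.HasFrobCharpolyAt v (Literature.NumberTheory.Automorphic.arithFrobPolyOfSatake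 ι' v.residueCard 1 α) ∧ σ₂.HasFrobCharpolyAt v (Literature.NumberTheory.Automorphic.arithFrobPolyOfSatake ι₂' v.residueCard 1 α))) → (2 ≤ n ∧ ∃ χ : Literature.NumberTheory.GaloisRepresentations.FramedGaloisRep K (PadicAlgCl ℓ) 1, (χ.toGaloisRep.IsIrreducible ∧ (∀ (L : Type) [Field L] [NumberField L] [Algebra K L], (χ.restrictField L).toGaloisRep.IsIrreducible) ∧ ((∀ᶠ v : IsDedekindDomain.HeightOneSpectrum (NumberField.RingOfIntegers K) in cofinite, χ.IsUnramifiedAt v) ∧ ∀ (v : IsDedekindDomain.HeightOneSpectrum (NumberField.RingOfIntegers K)) (hv : ((ℓ : ℕ) : NumberField.RingOfIntegers K) ∈ v.asIdeal), (Literature.NumberTheory.PAdicHodge.fontainePstAdicCompletion v ℓ hv).IsDeRhamFramed (χ.toLocal v)) ∧ (∀ (v : IsDedekindDomain.HeightOneSpectrum (NumberField.RingOfIntegers K)) (hv : ((ℓ : ℕ) : NumberField.RingOfIntegers K) ∈ v.asIdeal), (Literature.NumberTheory.PAdicHodge.fontainePstAdicCompletion v ℓ hv).IsCrystallineFramed (χ.toLocal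 v)) ∧ (∀ w : IsDedekindDomain.HeightOneSpectrum (NumberField.RingOfIntegers K), ((ℓ : ℕ) : NumberField.RingOfIntegers K) ∉ w.asIdeal → χ.IsUnramifiedAt w)) ∧ ∃ (K₀ : Type) (_ : Field K₀) (_ : NumberField K₀) (_ : Algebra K₀ K) (ρ₀ : Literature.NumberTheory.GaloisRepresentations.FramedGaloisRep K₀ (PadicAlgCl ℓ) n), Module.finrank ℚ K₀ < Module.finrank ℚ K ∧ (ρ₀.toGaloisRep.IsIrreducible ∧ (∀ (L : Type) [Field L] [NumberField L] [Algebra K₀ L], (ρ₀.restrictField L).toGaloisRep.IsIrreducible) ∧ ((∀ᶠ v : IsDedekindDomain.HeightOneSpectrum (NumberField.RingOfIntegers K₀) in cofinite, ρ₀.IsUnramifiedAt v) ∧ ∀ (v : IsDedekindDomain.HeightOneSpectrum (NumberField.RingOfIntegers K₀)) (hv : ((ℓ : ℕ) : NumberField.RingOfIntegers K₀) ∈ v.asIdeal), (Literature.NumberTheory.PAdicHodge.fontainePstAdicCompletion v ℓ hv).IsDeRhamFramed (ρ₀.toLocal v)) ∧ (∀ (v : IsDedekindDomain.HeightOneSpectrum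 (NumberField.RingOfIntegers K₀)) (hv : ((ℓ : ℕ) : NumberField.RingOfIntegers K₀) ∈ v.asIdeal), (Literature.NumberTheory.PAdicHodge.fontainePstAdicCompletion v ℓ hv).IsCrystallineFramed (ρ₀.toLocal v)) ∧ (∀ w : IsDedekindDomain.HeightOneSpectrum (NumberField.RingOfIntegers K₀), ((ℓ : ℕ) : NumberField.RingOfIntegers K₀) ∉ w.asIdeal → ρ₀.IsUnramifiedAt w)) ∧ ∀ g : Field.absoluteGaloisGroup K, Literature.NumberTheory.GaloisRepresentations.FramedRep.charpoly ρ g = (Matrix.kroneckerMap (· * ·) (((ρ₀.restrictField K) g : GL (Fin n) (PadicAlgCl ℓ)) : Matrix (Fin n) (Fin n) (PadicAlgCl ℓ)) ((χ g : GL (Fin 1) (PadicAlgCl ℓ)) : Matrix (Fin 1) (Fin 1) (PadicAlgCl ℓ))).charpoly) → ∀ (ι₂ : PadicAlgCl 2 ≃+* ℂ), ∃ ρ₂ : Literature.NumberTheory.GaloisRepresentations.FramedGaloisRep K (PadicAlgCl 2) n, (∀ᶠ v : IsDedekindDomain.HeightOneSpectrum (NumberField.RingOfIntegers K) in cofinite,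 ρ₂.IsUnramifiedAt v) ∧ (∀ᶠ v : IsDedekindDomain.HeightOneSpectrum (NumberField.RingOfIntegers K) in cofinite, ∃ α : Multiset ℂ, ρ.HasFrobCharpolyAt v (Literature.NumberTheory.Automorphic.arithFrobPolyOfSatake ι v.residueCard 1 α) ∧ ρ₂.HasFrobCharpolyAt v (Literature.NumberTheory.Automorphic.arithFrobPolyOfSatake ι₂ v.residueCard 1 α)) := by
  intro K _ _ n hn ℓ _ hℓ ι ρ hirr hLie hgeo hcrys hlvl IH hB ι₂
  obtain ⟨hn2, χ, ⟨hχirr, hχLie, hχgeo, hχcrys, hχlvl⟩, K₀, _, _, _, ρ₀, hdeg, ⟨hirr₀, hLie₀, hgeo₀, hcrys₀, hlvl₀⟩, hchar⟩ := hB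
  -- companions from the carried induction hypothesis: ρ₀ at the slice (n, [K₀:ℚ]), χ at the slice (1, [K:ℚ])
  obtain ⟨ρ₀₂, hur₀₂, hmatch₀⟩ :=
    IH (Module.finrank ℚ K₀) n (Or.inr ⟨rfl, hdeg⟩) K₀ rfl hn ℓ hℓ ι ρ₀ hirr₀ hLie₀ hgeo₀ hcrys₀ hlvl₀ ι₂
  obtain ⟨χ₂, hurχ₂, hmatchχ⟩ :=
    IH (Module.finrank ℚ K) 1 (Or.inl (by omega)) K rfl Nat.one_pos ℓ hℓ ι χ hχirr hχLie hχgeo hχcrys hχlvl ι₂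
  have hgood := eventually_forall_under_eq (E := K) ((hgeo₀.1.and hur₀₂).and hmatch₀)
  refine ⟨FramedRep.reindex (finCongr (Nat.mul_one n)) (FramedRep.tensor (ρ₀₂.restrictField K) χ₂), ?_, ?_⟩
  · filter_upwards [ρ₀₂.eventually_isUnramifiedAt_restrictField (E := K) hur₀₂, hurχ₂] with w h₁ h₂
    intro 𝔓 h𝔓 g hg
    rw [FramedRep.reindex_apply_eq_one_iff, FramedRep.tensor_apply, h₁ 𝔓 h𝔓 g hg, h₂ 𝔓 h𝔓 g hg, glKronecker_one]
  · filter_upwards [hgood, hmatchχ] with w hw hχw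
    obtain ⟨⟨hu₀, hu₀₂⟩, α, hα₀, hα₀₂⟩ := hw (w.under (𝓞 K₀)) rfl
    obtain ⟨β, hβ, hβ₂⟩ := hχw
    refine ⟨((α.map (· ^ w.asIdeal.inertiaDeg (𝓞 K₀))) ×ˢ β).map fun c => c.1 * c.2, ?_, ?_⟩
    · intro 𝔓 h𝔓 g hg
      have e₁ := ((hasFrobCharpolyAt_restrictField_arithFrobPolyOfSatake (L := K) ι ρ₀ (w := w)
        (v := w.under (𝓞 K₀)) rfl hu₀ 1 hα₀).2 𝔓 h𝔓 g hg).trans (arithFrobPolyOfSatake_one_eq ι _ _)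
      have e₂ := (hβ 𝔓 h𝔓 g hg).trans (arithFrobPolyOfSatake_one_eq ι _ β)
      rw [hchar g, charpoly_kronecker_of_eq_prod e₁ e₂, arithFrobPolyOfSatake_one_product]
    · intro 𝔓 h𝔓 g hg
      have e₁ := ((hasFrobCharpolyAt_restrictField_arithFrobPolyOfSatake (L := K) ι₂ ρ₀₂ (w := w)
        (v := w.under (𝓞 K₀)) rfl hu₀₂ 1 hα₀₂).2 𝔓 h𝔓 g hg).trans (arithFrobPolyOfSatake_one_eq ι₂ _ _)
      have e₂ := (hβ₂ 𝔓 h𝔓 g hg).trans (arithFrobPolyOfSatake_one_eq ι₂ _ β)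
      rw [FramedRep.charpoly_reindex, FramedRep.charpoly, FramedRep.tensor_apply, coe_glKronecker, Matrix.charpoly_reindex,
        charpoly_kronecker_of_eq_prod e₁ e₂, arithFrobPolyOfSatake_one_product]

end Summit.Langlands.Langlands.Theorems.LevelOneDyadic.PrimitiveProofs

/-! ## Settled: TP and FD hold, so the residual of the lineage is EXACTLY the primitive core PR (R ⟺ PR, a theorem). -/

namespace Summit.Langlands.Langlands.Theorems.LevelOneDyadic.Primitive

open Summit.Langlands.Langlands.Theorems.LevelOneDyadic.Clifford (LieIrreducibleCompanion)
open Summit.Langlands.Langlands.Theorems.LevelOneDyadic.Potential (PotentialCompanions)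

/-- **TP holds** (cell settled outright). -/
theorem kroneckerCompanionCell_holds : KroneckerCompanionCell := PrimitiveProofs.kroneckerCompanionCell_text

/-- **FD holds** (cell settled outright). -/
theorem baseChangedCompanionCell_holds : BaseChangedCompanionCell := PrimitiveProofs.baseChangedCompanionCell_text

/-- **R ⟺ PR** — `Clifford.LieIrreducibleCompanion` (stmt-Langlands-33380) is EQUIVALENT to its ⊗-primitive, twisted-field-primitive core (v2 dials):
the minimal counterexample to level-one dyadic companions is primitive.  EXACT, modulo nothing. -/
theorem primitiveCompanionCore_iff_lieIrreducibleCompanion : PrimitiveCompanionCore ↔ LieIrreducibleCompanion :=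
  primitiveCompanionCore_iff_R kroneckerCompanionCell_holds baseChangedCompanionCell_holds

/-- R ⟸ PR alone. -/
theorem lieIrreducibleCompanion_of_primitiveCore (hPR : PrimitiveCompanionCore) : LieIrreducibleCompanion :=
  primitiveCompanionCore_iff_lieIrreducibleCompanion.1 hPR

/-- PC (stmt-Langlands-33717) ⟸ PR alone. -/
theorem potentialCompanions_of_primitiveCore (hPR : PrimitiveCompanionCore) : PotentialCompanions :=
  potentialCompanions_of_primitive kroneckerCompanionCell_holds baseChangedCompanionCell_holds hPR

end Summit.Langlands.Langlands.Theorems.LevelOneDyadic.Primitive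

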